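import Literature.NumberTheory.Sieve.LargeSieveInequality
import HarnessLib

/-!
# The large sieve inequality for Hilbert-space-valued coefficients (Mauduit–Rivat 2015, Lemma 6; proved)

Everything in this file is PROVED. C. Mauduit, J. Rivat, *Prime numbers along Rudin–Shapiro
sequences*, J. Eur. Math. Soc. 17 (2015), Lemma 6 / (23) is the classical large sieve
inequality at the Farey points,
`∑_{q≤Q} ∑_{(a,q)=1} |∑_{n=1}^N z_n e(an/q)|² ≤ (N − 1 + Q²) ∑ |z_n|²`,
used in the proof of their Prop. 1 ((41)–(44)) for the coefficients `c_{κ,ρ₁}(u,h)`. In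
C. Müllner's matrix-valued generalisation (Duke Math. J. 166 (2017), Prop. 5.4: "the results
change at most by a factor `√d`") these coefficients are matrices with the Frobenius norm, so we
record the inequality for coefficients in an arbitrary complex inner product space `E`, with the
constant `N + 1 + 2Q²` of the tree's scalar version
(`Sieve.LargeSieve.largeSieve_farey`, from Huxley's well-spaced large sieve):

* `largeSieve_farey_hilbert` —
  `∑_{q≤Q} ∑_{b<q,(b,q)=1} ‖∑_{M₀<n≤M₀+N} e(bn/q) • z n‖² ≤ (N + 1 + 2Q²) ∑ ‖z n‖²`.

The proof expands `‖x‖² = ∑_i |⟨b_i, x⟩|²` in an orthonormal basis of the (finite-dimensional)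
span of the coefficients and applies the scalar inequality coordinatewise.

## References
* C. Mauduit, J. Rivat, J. Eur. Math. Soc. 17 (2015), Lemma 6, (23), p. 2602. [MauduitRivat2015]
* C. Müllner, Duke Math. J. 166 (2017), §5.4 (arXiv:1602.03042, p. 26). [Mullner2017]
-/

noncomputable section

open Finset Complex Module
open scoped FourierTransform InnerProductSpace

namespace Literature.NumberTheory.LFunctions.MauduitRivat

open Literature.NumberTheory.Sieve.LargeSieve (largeSieve_farey)

section FiniteDimensional

variable {E : Type*} [NormedAddCommGroup E] [InnerProductSpace ℂ E] [FiniteDimensional ℂ E]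

/-- The large sieve at Farey points for coefficients in a finite-dimensional complex inner
product space (coordinatewise from the scalar inequality). [cite: MauduitRivat2015, Lemma 6] -/
theorem largeSieve_farey_finiteDimensional (z : ℤ → E) (M₀ : ℤ) (N Q : ℕ) :
    ∑ q ∈ Icc 1 Q, ∑ b ∈ range q with b.Coprime q,
        ‖∑ n ∈ Ioc M₀ (M₀ + N), (𝐞 ((b : ℝ) * n / q) : ℂ) • z n‖ ^ 2 ≤
      ((N : ℝ) + 1 + 2 * (Q : ℝ) ^ 2) * ∑ n ∈ Ioc M₀ (M₀ + N), ‖z n‖ ^ 2 := by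
  set B := stdOrthonormalBasis ℂ E with hB
  -- coordinates
  have hcoord : ∀ x : E, ‖x‖ ^ 2 = ∑ i, ‖⟪B i, x⟫_ℂ‖ ^ 2 :=
    fun x => (B.sum_sq_norm_inner_right x).symm
  have hinner : ∀ (i : Fin (finrank ℂ E)) (q b : ℕ),
      ⟪B i, ∑ n ∈ Ioc M₀ (M₀ + N), (𝐞 ((b : ℝ) * n / q) : ℂ) • z n⟫_ℂ =
        ∑ n ∈ Ioc M₀ (M₀ + N), ⟪B i, z n⟫_ℂ * (𝐞 ((b : ℝ) * n / q) : ℂ) := by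
    intro i q b
    rw [inner_sum]
    exact sum_congr rfl fun n _ => by rw [inner_smul_right, mul_comm]
  calc ∑ q ∈ Icc 1 Q, ∑ b ∈ range q with b.Coprime q,
        ‖∑ n ∈ Ioc M₀ (M₀ + N), (𝐞 ((b : ℝ) * n / q) : ℂ) • z n‖ ^ 2
      = ∑ q ∈ Icc 1 Q, ∑ b ∈ range q with b.Coprime q,
          ∑ i, ‖∑ n ∈ Ioc M₀ (M₀ + N), ⟪B i, z n⟫_ℂ * (𝐞 ((b : ℝ) * n / q) : ℂ)‖ ^ 2 := by
        refine sum_congr rfl fun q _ => sum_congr rfl fun b _ => ?_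
        rw [hcoord]
        exact Fintype.sum_congr _ _ fun i => by rw [hinner]
    _ = ∑ i, ∑ q ∈ Icc 1 Q, ∑ b ∈ range q with b.Coprime q,
          ‖∑ n ∈ Ioc M₀ (M₀ + N), ⟪B i, z n⟫_ℂ * (𝐞 ((b : ℝ) * n / q) : ℂ)‖ ^ 2 := by
        rw [sum_comm]
        exact sum_congr rfl fun q _ => sum_comm
    _ ≤ ∑ i, ((N : ℝ) + 1 + 2 * (Q : ℝ) ^ 2) * ∑ n ∈ Ioc M₀ (M₀ + N), ‖⟪B i, z n⟫_ℂ‖ ^ 2 :=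
        sum_le_sum fun i _ => largeSieve_farey (fun n => ⟪B i, z n⟫_ℂ) M₀ N Q
    _ = ((N : ℝ) + 1 + 2 * (Q : ℝ) ^ 2) * ∑ n ∈ Ioc M₀ (M₀ + N), ‖z n‖ ^ 2 := by
        rw [← mul_sum, sum_comm]
        congr 1
        exact sum_congr rfl fun n _ => (hcoord (z n)).symm

end FiniteDimensional

section General

variable {E : Type*} [NormedAddCommGroup E] [InnerProductSpace ℂ E]

/-- **The large sieve inequality (Farey points) for coefficients in a complex inner product
space** (Mauduit–Rivat's Lemma 6 / (23), vector-valued as needed for Müllner's matrix-valued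
Prop. 5.4): for `z : ℤ → E`, `M₀ ∈ ℤ`, `N, Q ∈ ℕ`,
`∑_{q≤Q} ∑_{b<q,(b,q)=1} ‖∑_{M₀<n≤M₀+N} e(bn/q) • z n‖² ≤ (N + 1 + 2Q²) ∑_{M₀<n≤M₀+N} ‖z n‖²`.
[cite: MauduitRivat2015, Lemma 6, (23)] -/
theorem largeSieve_farey_hilbert (z : ℤ → E) (M₀ : ℤ) (N Q : ℕ) :
    ∑ q ∈ Icc 1 Q, ∑ b ∈ range q with b.Coprime q,
        ‖∑ n ∈ Ioc M₀ (M₀ + N), (𝐞 ((b : ℝ) * n / q) : ℂ) • z n‖ ^ 2 ≤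
      ((N : ℝ) + 1 + 2 * (Q : ℝ) ^ 2) * ∑ n ∈ Ioc M₀ (M₀ + N), ‖z n‖ ^ 2 := by
  classical
  -- work inside the finite-dimensional span of the coefficients
  set S : Finset E := (Ioc M₀ (M₀ + N)).image z with hS
  set W : Submodule ℂ E := Submodule.span ℂ (S : Set E) with hW
  have hmem : ∀ n ∈ Ioc M₀ (M₀ + N), z n ∈ W := fun n hn =>
    Submodule.subset_span (by rw [hS, coe_image]; exact ⟨n, by exact_mod_cast hn, rfl⟩)
  -- the lifted coefficients
  let w : ℤ → W := fun n => if h : n ∈ Ioc M₀ (M₀ + N) then ⟨z n, hmem n h⟩ else 0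
  have hw : ∀ n ∈ Ioc M₀ (M₀ + N), ((w n : W) : E) = z n := fun n hn => by
    simp only [w, dif_pos hn]
  have h := largeSieve_farey_finiteDimensional w M₀ N Q
  have hL : ∀ (q b : ℕ), ‖∑ n ∈ Ioc M₀ (M₀ + N), (𝐞 ((b : ℝ) * n / q) : ℂ) • z n‖ =
      ‖∑ n ∈ Ioc M₀ (M₀ + N), (𝐞 ((b : ℝ) * n / q) : ℂ) • w n‖ := by
    intro q b
    have e1 : ∑ n ∈ Ioc M₀ (M₀ + N), (𝐞 ((b : ℝ) * n / q) : ℂ) • z n =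
        ((∑ n ∈ Ioc M₀ (M₀ + N), (𝐞 ((b : ℝ) * n / q) : ℂ) • w n : W) : E) := by
      rw [Submodule.coe_sum]
      refine sum_congr rfl fun n hn => ?_
      rw [Submodule.coe_smul, hw n hn]
    rw [e1, Submodule.norm_coe]
  have hR : ∑ n ∈ Ioc M₀ (M₀ + N), ‖z n‖ ^ 2 = ∑ n ∈ Ioc M₀ (M₀ + N), ‖w n‖ ^ 2 :=
    sum_congr rfl fun n hn => by rw [← hw n hn, Submodule.norm_coe]
  rw [hR]
  calc ∑ q ∈ Icc 1 Q, ∑ b ∈ range q with b.Coprime q,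
        ‖∑ n ∈ Ioc M₀ (M₀ + N), (𝐞 ((b : ℝ) * n / q) : ℂ) • z n‖ ^ 2
      = ∑ q ∈ Icc 1 Q, ∑ b ∈ range q with b.Coprime q,
        ‖∑ n ∈ Ioc M₀ (M₀ + N), (𝐞 ((b : ℝ) * n / q) : ℂ) • w n‖ ^ 2 :=
        sum_congr rfl fun q _ => sum_congr rfl fun b _ => by rw [hL]
    _ ≤ _ := h

end General

end Literature.NumberTheory.LFunctions.MauduitRivat
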